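import Summits.ResolutionOfSingularities.ResolutionOfSingularities.Theorems.FrobeniusLadderFRationalResolutionSummandChart
import Summits.ResolutionOfSingularities.ResolutionOfSingularities.Theorems.FrobeniusLadderFRationalResolutionFixedChart
import HarnessLib

/-!
# Crux `FrobeniusLadder.FRationalResolution` (stmt-ResolutionOfSingularities-15317), line `redirect`,
# stub `stub_diagonalizableQuotientResolution` — item (F2) of MEMO-15317-leafhand2-g20 §3 ASSEMBLED in the stub's
# frame: a point whose unit-degree subgroup `B_𝔔` is a DIRECT SUMMAND of `A` is the image of a FIXED point of a
# quotient chart of the same shape and the SAME invariants — every characteristic, no tameness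

`…FixedChart.exists_fixed_chart` (tame: `|A| ∈ k^×`) re-charts every point to a fixed point through the finite
étale torsor `Spec S^{(B)} → Spec S₀`. In the wild case that torsor is inseparable and `S^{(B)}` has other
singularities than `S₀`. The split-off step avoids it: if `B = B_𝔔` has a complement `C` (`B ⊔ C = ⊤`,
`B ⊓ C = ⊥`), then after inverting one element of `S₀ ∖ 𝔮` (`…AwayUnits`) the sub-ring `S_t^{(C)} = ⊕_{c ∈ C} (S_t)_c`
is REGULAR (`S_t` is free over it on homogeneous units of the classes of `A/C ≅ B`, faithfully flat descent —
`…SummandChart.isRegularRing_gradeZero_of_units`), of finite type, graded by `C` with degree-zero part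
`(S_t)_0 = (S_0)_t` (`…SummandChart.exists_kernelGrading`, `exists_ringEquiv_gradeZero`), and `𝔔 S_t ∩ S_t^{(C)}` is
a FIXED prime (`B ⊓ C = ⊥`). Composing `S₀ → (S₀)_t ≅ (S_t^{(C)})_0` (a localization, étale) with `φ`:

* ★★ `exists_fixed_chart_of_isCompl` — **for a chart `φ : Spec S₀ → X` of the stub's shape, a point `v`, a prime
  `𝔔` of `S` over `v` and a complement `C` of its unit-degree subgroup `B_𝔔`: a chart `φ' : Spec S'₀ → X` of the
  same shape (`S'` regular of finite type over `k`, graded by the finite group `C`, `φ'` étale and compatible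
  with the structure maps) with a FIXED prime `𝔔'` (`S'_c ⊆ 𝔔'` for `c ≠ 0`) over a point `v'` with
  `φ' v' = φ v`.**

E.g. every point when `A` is elementary abelian (`(μ_p)^r`-quotients in characteristic `p`, all wild); together
with `…FixedChart` (tame) this leaves, for item (F2), only points whose unit subgroup is NOT a direct summand of `A`
(e.g. `pℤ/p² < ℤ/p²`), for which the root-adjunction step of MEMO-15317-leafhand2-g21 is designed. Honest label: helper toward ONE leaf stub; no stub,
crux or summit closed. No definitions, no named facts, no sorry.
[folklore; cite: SGA3, Exp. VIII §4–5; EGAII, (2.2.1)–(2.2.2)] [cite: StacksProject, Tag 07NG]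
-/

noncomputable section

-- single-problem summit: the doubled namespace component is forced
set_option linter.dupNamespace false

open CategoryTheory AlgebraicGeometry
open Literature.RingTheory.GradedAlgebra
open Literature.AlgebraicGeometry.Resolution
open Literature.AlgebraicGeometry.Resolution.DiagonalizableQuotient

namespace Summit.ResolutionOfSingularities.ResolutionOfSingularities.Theorems.FRationalResolution.FixedChartOfSummand

universe u v w

/-- A ring with a proper ideal is nontrivial. [folklore] -/
theorem nontrivial_of_ne_top {R : Type u} [CommRing R] (I : Ideal R) (hI : I ≠ ⊤) : Nontrivial R := by
  refine ⟨⟨0, 1, fun h => hI ?_⟩⟩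
  rw [Ideal.eq_top_iff_one, ← h]
  exact I.zero_mem

/-- ★★ **Item (F2), split case: a point whose unit-degree subgroup is a direct summand is the image of a FIXED
point of a quotient chart with the same invariants.** Let `φ : Spec S₀ → X` be a chart of the stub's shape (`S`
regular of finite type over the field `k`, graded by the finite abelian group `A`, `φ` étale with
`φ ≫ g = Spec (k → S₀)`), `v` a point of `Spec S₀`, `𝔔` a prime of `S` over `v`, `B` the subgroup of degrees
carrying an element outside `𝔔`, and `C` a complement of `B` (`B ⊔ C = ⊤`, `B ⊓ C = ⊥`). Then there are a chart
`φ' : Spec S'₀ → X` of the same shape — `S'` regular of finite type graded by the finite group `C` — and a prime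
`𝔔'` of `S'` contracting to a point `v'` with `φ' v' = φ v`, which is FIXED: `S'_c ⊆ 𝔔'` for every `c ≠ 0`.
No tameness hypothesis. [folklore; cite: SGA3, Exp. VIII §4–5] [cite: StacksProject, Tag 07NG] -/
theorem exists_fixed_chart_of_isCompl (k : Type) [Field k] (X : Scheme.{0}) (g : X ⟶ Spec (.of k))
    (A : Type) [AddCommGroup A] [Finite A] [DecidableEq A] (S : Type) [CommRing S] [Algebra k S]
    (𝒮 : A → Submodule k S) [GradedAlgebra 𝒮] [Algebra.FiniteType k S] [IsRegularRing S]
    (φ : Spec (.of (𝒮 0)) ⟶ X) [Etale φ]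
    (hφg : φ ≫ g = Spec.map (CommRingCat.ofHom (algebraMap k (𝒮 0))))
    (v : Spec (.of (𝒮 0))) (𝔔 : Ideal S) [𝔔.IsPrime] (h𝔔v : 𝔔.comap (algebraMap (𝒮 0) S) = v.asIdeal)
    (B C : AddSubgroup A) (hB : ∀ a : A, a ∈ B ↔ ∃ s ∈ 𝒮 a, s ∉ 𝔔) (hsup : B ⊔ C = ⊤) (hinf : B ⊓ C = ⊥) :
    ∃ (A' : Type) (_ : AddCommGroup A') (_ : Finite A') (_ : DecidableEq A')
      (S' : Type) (_ : CommRing S') (_ : Algebra k S') (𝒮' : A' → Submodule k S')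
      (_ : GradedAlgebra 𝒮'),
      Algebra.FiniteType k S' ∧ IsRegularRing S' ∧
      ∃ (φ' : Spec (.of (𝒮' 0)) ⟶ X), Etale φ' ∧
        φ' ≫ g = Spec.map (CommRingCat.ofHom (algebraMap k (𝒮' 0))) ∧
        ∃ (v' : Spec (.of (𝒮' 0))) (𝔔' : Ideal S') (_ : 𝔔'.IsPrime),
          𝔔'.comap (algebraMap (𝒮' 0) S') = v'.asIdeal ∧
          (∀ c : A', c ≠ 0 → ∀ s ∈ 𝒮' c, s ∈ 𝔔') ∧ φ' v' = φ v := by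
  classical
  have hA : AddMonoid.IsTorsion A := fun a => isOfFinAddOrder_of_finite a
  -- localize away from one degree-zero element: global homogeneous units in the degrees of `B`
  obtain ⟨t, ht0, _, hT, hloc⟩ := AwayUnits.exists_away_units (k := k) 𝒮 𝔔 B hB
  let L : Type := Localization.Away t
  obtain ⟨hprime, hcomap, hBL, -, hunitL⟩ := hloc L
  let ℒ : A → Submodule k L := locPiece 𝒮 (Submonoid.powers t) hT L
  letI instℒ : GradedAlgebra ℒ := (nonempty_gradedAlgebra_locPiece 𝒮 _ hT L).some
  set 𝔔L : Ideal L := 𝔔.map (algebraMap S L) with h𝔔L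
  haveI : 𝔔L.IsPrime := hprime
  haveI : Nontrivial L := nontrivial_of_ne_top 𝔔L hprime.ne_top
  haveI : Algebra.FiniteType k L := by
    show Algebra.FiniteType k (Localization (Submonoid.powers t))
    infer_instance
  haveI : IsRegularRing L := isRegularRing_localization (Submonoid.powers t)
  -- coarsen along `A → A/C`; the sub-chart ring `L^{(C)} = ℒ' 0` graded by `C = ker`
  let f : A →+ A ⧸ C := QuotientAddGroup.mk' C
  have hker : f.ker = C := QuotientAddGroup.ker_mk' C
  obtain ⟨ℒ', instℒ', hℒ', -⟩ := Coarsening.exists_coarsening ℒ f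
  obtain ⟨𝒯, inst𝒯, h𝒯⟩ := SummandChart.exists_kernelGrading ℒ f ℒ' hℒ'
  have hA' : AddMonoid.IsTorsion (A ⧸ C) := fun c => by
    obtain ⟨a, rfl⟩ := QuotientAddGroup.mk_surjective c
    exact f.isOfFinAddOrder (hA a)
  -- units in every class of `A/C`, regularity and finiteness of `L^{(C)}`
  have hsup' : B ⊔ f.ker = ⊤ := by rw [hker]; exact hsup
  have hinf' : B ⊓ f.ker = ⊥ := by rw [hker]; exact hinf
  have hunits : ∀ c : A ⧸ C, ∃ u ∈ ℒ' c, IsUnit u :=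
    SummandChart.exists_unit_coarse_of_sup_eq_top ℒ f ℒ' hℒ' B hunitL hsup'
      (QuotientAddGroup.mk'_surjective C)
  have hreg : IsRegularRing (ℒ' 0) := SummandChart.isRegularRing_gradeZero_of_units ℒ' hA' hunits
  have hft : Algebra.FiniteType k (ℒ' 0) := SummandChart.finiteType_gradeZero ℒ f ℒ' hℒ' hA'
  -- the degree-zero parts: `S₀ → (S_t)_0 ≅ (L^{(C)})_0`
  obtain ⟨e, he⟩ := SummandChart.exists_ringEquiv_gradeZero ℒ f ℒ' hℒ' 𝒯 h𝒯
  let j : 𝒮 0 →+* ℒ 0 := locPieceZeroHom 𝒮 (Submonoid.powers t) hT L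
  have hjval : ∀ a, (j a : L) = algebraMap S L a := fun a => rfl
  have hjet : j.Etale := FixedChart.etale_locPieceZeroHom 𝒮 ht0 hT L
  -- NB: `𝒯 0` is the degree-zero part of a degree-zero part; ring-level terms about it are written with explicit
  -- type arguments so that the two instance paths to its semiring structure are compared by definitional unfolding.
  have hejval : ∀ a, ((e (j a) : ℒ' 0) : L) = algebraMap S L a := fun a => by rw [he, hjval]
  -- `Spec e ≫ Spec j` is étale (an isomorphism followed by a localization)
  haveI : Etale (Spec.map (CommRingCat.ofHom j)) := (HasRingHomProperty.Spec_iff (P := @Etale)).mpr hjet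
  haveI : IsIso (CommRingCat.ofHom (R := ℒ 0) (S := 𝒯 0) e.toRingHom) := by
    show IsIso (RingEquiv.toCommRingCatIso (R := ℒ 0) (S := 𝒯 0) e).hom
    infer_instance
  let φ' : Spec (.of (𝒯 0)) ⟶ X :=
    Spec.map (CommRingCat.ofHom (R := ℒ 0) (S := 𝒯 0) e.toRingHom) ≫ Spec.map (CommRingCat.ofHom j) ≫ φ
  haveI hφ'et : Etale φ' := inferInstance
  -- compatibility with the structure maps
  have hφ'g : φ' ≫ g = Spec.map (CommRingCat.ofHom (R := k) (S := 𝒯 0) (algebraMap k (𝒯 0))) := by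
    simp only [φ', Category.assoc, hφg, ← Spec.map_comp]
    congr 1
    refine CommRingCat.hom_ext (RingHom.ext fun c => ?_)
    apply Subtype.ext
    apply Subtype.ext
    simp only [CommRingCat.hom_comp, CommRingCat.hom_ofHom, RingHom.coe_comp, Function.comp_apply]
    show ((e (j (algebraMap k (𝒮 0) c)) : ℒ' 0) : L) = ((algebraMap k (𝒯 0) c : ℒ' 0) : L)
    rw [hejval, SetLike.GradeZero.coe_algebraMap, SetLike.GradeZero.coe_algebraMap,
      SetLike.GradeZero.coe_algebraMap, ← IsScalarTower.algebraMap_apply]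
  -- the fixed prime of `L^{(C)}` and its point
  let 𝔔T : Ideal (ℒ' 0) := 𝔔L.comap (algebraMap (ℒ' 0) L)
  haveI h𝔔T : 𝔔T.IsPrime := Ideal.IsPrime.comap _
  let v' : Spec (.of (𝒯 0)) := ⟨𝔔T.comap (algebraMap (𝒯 0) (ℒ' 0)), Ideal.IsPrime.comap _⟩
  have hfix : ∀ c : f.ker, c ≠ 0 → ∀ s ∈ 𝒯 c, s ∈ 𝔔T := fun c hc s hs =>
    SummandChart.mem_of_mem_kernelGrading_of_disjoint ℒ f ℒ' 𝒯 h𝒯 𝔔L B hBL hinf' c hc s hs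
  have hv' : Spec.map (CommRingCat.ofHom j) (Spec.map (CommRingCat.ofHom (R := ℒ 0) (S := 𝒯 0) e.toRingHom) v') = v := by
    apply PrimeSpectrum.ext
    rw [Spec.map_apply, PrimeSpectrum.comap_asIdeal, Spec.map_apply, PrimeSpectrum.comap_asIdeal]
    show ((𝔔T.comap (algebraMap (𝒯 0) (ℒ' 0))).comap e.toRingHom).comap j = v.asIdeal
    rw [Ideal.comap_comap, Ideal.comap_comap, Ideal.comap_comap, ← h𝔔v, ← hcomap, Ideal.comap_comap]
    congr 1
    ext a
    exact hejval a
  have hφ'v : φ' v' = φ v := by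
    show φ (Spec.map (CommRingCat.ofHom j) (Spec.map (CommRingCat.ofHom (R := ℒ 0) (S := 𝒯 0) e.toRingHom) v')) = φ v
    rw [hv']
  haveI : Finite f.ker := Subtype.finite
  exact ⟨f.ker, inferInstance, inferInstance, inferInstance, ℒ' 0, inferInstance, inferInstance, 𝒯, inst𝒯,
    hft, hreg, φ', hφ'et, hφ'g, v', 𝔔T, h𝔔T, rfl, hfix, hφ'v⟩

end Summit.ResolutionOfSingularities.ResolutionOfSingularities.Theorems.FRationalResolution.FixedChartOfSummand

end
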